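import Mathlib
import HarnessLib
import Literature.RingTheory.CohomologyAnnihilator.Basic
import Literature.RingTheory.CohomologyAnnihilator.SyzygyBasic
import Literature.RingTheory.CohomologyAnnihilator.SyzygyDescent
import Literature.RingTheory.CohomologyAnnihilator.SyzygyBaseChange
import Literature.RingTheory.CohomologyAnnihilator.Localization
import Literature.RingTheory.CohomologyAnnihilator.RegularRing
import Summits.ResolutionOfSingularities.ResolutionOfSingularities.Theorems.HomologicalConductorNoZenoStableAnnihilatorReduction
import Summits.ResolutionOfSingularities.ResolutionOfSingularities.Theorems.HomologicalConductorPersistenceSurfaceFiniteCover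
import Summits.ResolutionOfSingularities.ResolutionOfSingularities.Theorems.HomologicalConductorPersistenceHypersurfaceJacobian
import Summits.ResolutionOfSingularities.ResolutionOfSingularities.Theorems.HomologicalConductorPersistenceHypersurfacePeriodicity
import Summits.ResolutionOfSingularities.ResolutionOfSingularities.Theorems.HomologicalConductorPersistencePeriodicSaturation

/-!
# Periodic saturation of the cohomology annihilator at LOCALISED hypersurface stages:
# `ca(U⁻¹B) = caᵈ⁺¹(U⁻¹B)` for `B = S[z]` a power basis over `S` with `caᵈ⁺¹(S) = S`

Route `ResolutionOfSingularities/HomologicalConductor`, chain W4.4b, rung S-2 `PersistenceSurface`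
(stmt-ResolutionOfSingularities-19970); ORDER w44b-o9c of res-L1-w44b-plan-1 (06:42Z 2026-08-27):
«the LOCALISED form — our stages are local rings `(tower A m) = Localization.AtPrime`, so the consumer
needs the local form».  [OURS · L1 w44b · res-type-011; AI-written, weaker than expert review; NOT a
statement of the manuscript under study, and no statement of that manuscript is used.]

The global statement `ca(B) = caᵈ⁺¹(B)` (`…PeriodicSaturation.cohomologyAnnihilator_eq_of_powerBasis`)
rests on periodicity of `d`-th syzygies over `B` (`…HypersurfacePeriodicity.isSyzygy_two_self`).  Over a
localisation `C = U⁻¹B` the relative-hypersurface structure over `S` is lost, but periodicity survives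
STABLY: every `d`-th `C`-syzygy `K` of a finitely generated `C`-module satisfies `K ⊕ P' ≅ X ⊕ P` with
`X = C ⊗_B K₀` the base change of a `2`-periodic `B`-syzygy (descent of finitely generated modules along
the localisation, flat base change of syzygies, Schanuel's lemma — all in the tree).  Hence:

* `cohomologyAnnihilatorOfDegree_eq_of_stablyPeriodic` / `cohomologyAnnihilator_eq_of_stablyPeriodic` —
  **stable periodic saturation**: over a noetherian `T`, if every `d`-th syzygy is stably isomorphic
  (up to finitely generated projective summands) to a finitely generated periodic module, then
  `ca(T) = caᵈ⁺¹(T) = caⁿ(T)` (`n ≥ d + 1`) — CA1 + FC-1/FC-2 (`StablyAnnihilates.of_projective`,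
  `.prod`, p504042) + HC-R (`StablyAnnihilates.of_retract`, p501682);
* `cohomologyAnnihilatorOfDegree_localization_eq_of_powerBasis` /
  `cohomologyAnnihilator_localization_eq_of_powerBasis` — for `pb : PowerBasis S B`, `S` noetherian
  with `caᵈ⁺¹(S) = ⊤`, and ANY submonoid `U ⊆ B`: `ca(Localization U) = caᵈ⁺¹(Localization U)`;
* `cohomologyAnnihilator_localizationAtPrime_eq_of_powerBasis` — the local rings `B_Q`;
  `cohomologyAnnihilator_localization_adjoinRoot_eq_of_isRegularRing` (`B = S[X]/(f)`, `f` monic, `S`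
  regular of dimension `≤ d`), `cohomologyAnnihilator_localization_adjoinRoot_mvPolynomial_eq`
  (`S = k[x₁,…,x_d]`, any field `k`, any characteristic).

So `Sat_{d+1}` — a fortiori the chain's `SaturationFourSurface` shape `ca ⊆ ca⁴` on surface towers
(`d = 2`) — holds at every LOCAL RING of every hypersurface `S[X]/(f)` over a regular base, with no
recurrence hypothesis `(Rec)`.  What this is NOT: anything about non-hypersurface (non-Gorenstein)
stages; the identification of a given tower stage `tower A m` with such a local ring is the consumer's.

References (mechanism only; nothing is cited as a premise): D. Eisenbud, Trans. AMS 260 (1980) §5–6;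
H. Matsumura, *Commutative Ring Theory* §19 Lemma 3 (Schanuel); S. B. Iyengar, R. Takahashi, IMRN 2016
(arXiv:1404.1476) §2, Lemma 2.10 [`IyengarTakahashi2014`].
-/

noncomputable section

-- single-problem summit: the doubled namespace component `ResolutionOfSingularities` is forced
set_option linter.dupNamespace false

namespace Summit.ResolutionOfSingularities.ResolutionOfSingularities.Theorems.HomologicalConductor.PeriodicSaturationLocal

open CategoryTheory CategoryTheory.Abelian Literature.RingTheory.CohomologyAnnihilator
open Summit.ResolutionOfSingularities.ResolutionOfSingularities.Theorems.NoZeno.SandwichCluster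
open Summit.ResolutionOfSingularities.ResolutionOfSingularities.Theorems.HomologicalConductor.PersistenceSurfaceHullCover
open Summit.ResolutionOfSingularities.ResolutionOfSingularities.Theorems.HomologicalConductor.PersistenceSurfaceFiniteCover
open Summit.ResolutionOfSingularities.ResolutionOfSingularities.Theorems.HomologicalConductor.PersistenceHypersurfaceJacobian
open Summit.ResolutionOfSingularities.ResolutionOfSingularities.Theorems.HomologicalConductor.HypersurfacePeriodicity
open Summit.ResolutionOfSingularities.ResolutionOfSingularities.Theorems.HomologicalConductor.PeriodicSaturation
open scoped TensorProduct

universe u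

/-! ## Stable periodic saturation -/

section Stable

variable {T : Type u} [CommRing T]

/-- **Stable periodic saturation, levelled form.** Over a noetherian ring `T`: suppose every `d`-th
syzygy module `K` of every finitely generated module is STABLY PERIODIC — `K ⊕ P' ≅ X ⊕ P` with `P`,
`P'` finitely generated projective and `X` finitely generated and `q`-periodic (`IsSyzygy q X X`,
`q ≥ 1`). Then `caⁿ(T) = caᵈ⁺¹(T)` for all `n ≥ d + 1`.  Proof: for `x ∈ caᵐ⁺¹(T)`, `X = Ω^{q m} X` is
an `m`-th syzygy of a finitely generated module, so `x` stably annihilates `X` (CA1), hence `X ⊕ P`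
(FC-1/FC-2), hence `K ⊕ P'`, hence its retract `K` (HC-R); CA1 at level `d` concludes.  This is the
form of periodic saturation that survives LOCALISATION (syzygies descend only up to projective
summands, Schanuel). [OURS] -/
theorem cohomologyAnnihilatorOfDegree_eq_of_stablyPeriodic [IsNoetherianRing T] (d : ℕ)
    (hper : ∀ (M K : ModuleCat.{u} T), Module.Finite T M → IsSyzygy d M K →
      ∃ (X P P' : ModuleCat.{u} T), Module.Finite T X ∧ Module.Finite T P ∧ Projective P ∧
        Module.Finite T P' ∧ Projective P' ∧
        Nonempty (ModuleCat.of T (K × P') ≅ ModuleCat.of T (X × P)) ∧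
        ∃ q : ℕ, 0 < q ∧ IsSyzygy q X X)
    {n : ℕ} (hn : d + 1 ≤ n) :
    cohomologyAnnihilatorOfDegree T n = cohomologyAnnihilatorOfDegree T (d + 1) := by
  refine le_antisymm ?_ (cohomologyAnnihilatorOfDegree_mono hn)
  obtain ⟨m, rfl⟩ : ∃ m, n = m + 1 := ⟨n - 1, by omega⟩
  intro x hx
  rw [mem_cohomologyAnnihilatorOfDegree_succ_iff_forall_isSyzygy]
  intro M K hM hK
  obtain ⟨X, P, P', hXfin, hPfin, hP, hP'fin, hP', ⟨e⟩, q, hq, hXX⟩ := hper M K hM hK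
  haveI := hXfin; haveI := hPfin; haveI := hP'fin
  haveI : Module.Projective T P := moduleProjective_of_projective P hP
  haveI : Module.Projective T P' := moduleProjective_of_projective P' hP'
  -- `X = Ω^{q m} X` is an `m`-th syzygy of a finitely generated module
  obtain ⟨q', rfl⟩ : ∃ q', q = q' + 1 := ⟨q - 1, by omega⟩
  have hbig : IsSyzygy (m + q' * m) X X := by
    have := IsSyzygy.self_mul hXX m
    rw [show (q' + 1) * m = m + q' * m by ring] at this
    exact this
  obtain ⟨M', hM', hmX⟩ := exists_isSyzygy_split (q' * m) hbig
  haveI : Module.Finite T M' := finite_of_isSyzygy _ hXfin hM'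
  have hX : StablyAnnihilates T x X :=
    (mem_cohomologyAnnihilatorOfDegree_succ_iff_forall_isSyzygy x).mp hx M' X ‹_› hmX
  -- transport along `K × P' ≅ X × P` and retract onto `K`
  have hXP : StablyAnnihilates T x (ModuleCat.of T (X × P)) :=
    StablyAnnihilates.prod hX (StablyAnnihilates.of_projective x P)
  have hKP' : StablyAnnihilates T x (ModuleCat.of T (K × P')) := hXP.of_iso e.symm
  exact StablyAnnihilates.of_retract hKP' (ModuleCat.ofHom (LinearMap.inl T K P'))
    (ModuleCat.ofHom (LinearMap.fst T K P')) (by ext; rfl)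

/-- **Stable periodic saturation: `ca(T) = caᵈ⁺¹(T)`** under the stable-periodicity hypothesis on
`d`-th syzygies. [OURS] -/
theorem cohomologyAnnihilator_eq_of_stablyPeriodic [IsNoetherianRing T] (d : ℕ)
    (hper : ∀ (M K : ModuleCat.{u} T), Module.Finite T M → IsSyzygy d M K →
      ∃ (X P P' : ModuleCat.{u} T), Module.Finite T X ∧ Module.Finite T P ∧ Projective P ∧
        Module.Finite T P' ∧ Projective P' ∧
        Nonempty (ModuleCat.of T (K × P') ≅ ModuleCat.of T (X × P)) ∧
        ∃ q : ℕ, 0 < q ∧ IsSyzygy q X X) :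
    cohomologyAnnihilator T = cohomologyAnnihilatorOfDegree T (d + 1) := by
  refine le_antisymm ?_ (cohomologyAnnihilatorOfDegree_le _)
  intro x hx
  obtain ⟨n, hn⟩ := mem_cohomologyAnnihilator_iff.mp hx
  have hx' : x ∈ cohomologyAnnihilatorOfDegree T (max n (d + 1)) :=
    cohomologyAnnihilatorOfDegree_mono (le_max_left _ _) hn
  rwa [cohomologyAnnihilatorOfDegree_eq_of_stablyPeriodic d hper (le_max_right _ _)] at hx'

end Stable

/-! ## Localised hypersurface stages -/

section Local

variable {S : Type u} {B : Type u} [CommRing S] [CommRing B] [Algebra S B]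

/-- **Saturation at LOCALISED hypersurface stages, levelled form.** Let `S` be noetherian with
`caᵈ⁺¹(S) = S`, `B` an `S`-algebra with a power basis (e.g. `B = S[X]/(f)`, `f` monic) and `U ⊆ B` any
submonoid. Then `caⁿ(U⁻¹B) = caᵈ⁺¹(U⁻¹B)` for every `n ≥ d + 1`.  Proof (stable periodic saturation over
`C = U⁻¹B`): a finitely generated `C`-module `M` is `C ⊗_B M₀` for the `B`-span `M₀` of a generating
set (`isLocalizedModule_subtype_of_span_eq_top`, `IsLocalizedModule.isBaseChange`); a `d`-th
`B`-syzygy `K₀` of `M₀` is `S`-projective (`projective_restrictScalars_of_isSyzygy`) hence `2`-periodic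
(`HypersurfacePeriodicity.isSyzygy_two_self`); flat base change (`IsSyzygy.baseChange`,
`IsLocalization.flat`) makes `X = C ⊗_B K₀` a `2`-periodic `d`-th `C`-syzygy of `M`, and Schanuel
(`IsSyzygy.exists_stablyIso`) compares it with the given `d`-th syzygy `K`: `K ⊕ P' ≅ X ⊕ P`.
(Rank `0`: `B = 0 = C`.) [OURS] -/
theorem cohomologyAnnihilatorOfDegree_localization_eq_of_powerBasis [IsNoetherianRing S]
    (pb : PowerBasis S B) {d : ℕ} (hvan : cohomologyAnnihilatorOfDegree S (d + 1) = ⊤)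
    (U : Submonoid B) {n : ℕ} (hn : d + 1 ≤ n) :
    cohomologyAnnihilatorOfDegree (Localization U) n =
      cohomologyAnnihilatorOfDegree (Localization U) (d + 1) := by
  haveI : Module.Finite S B := pb.finite
  haveI : Module.Free S B := Module.Free.of_basis pb.basis
  haveI : IsNoetherianRing B := isNoetherian_of_tower S inferInstance
  haveI : IsNoetherianRing (Localization U) := IsLocalization.isNoetherianRing U _ inferInstance
  haveI : Module.Flat B (Localization U) := IsLocalization.flat (Localization U) U
  by_cases hdim : pb.dim = 0
  · haveI : Subsingleton B := by
      have e := pb.basis.equivFun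
      rw [hdim] at e
      exact e.toEquiv.subsingleton
    haveI : Subsingleton (Localization U) := (algebraMap B (Localization U)).codomain_trivial
    exact Subsingleton.elim _ _
  refine cohomologyAnnihilatorOfDegree_eq_of_stablyPeriodic d (fun M K hM hK => ?_) hn
  haveI := hM
  set C := Localization U
  -- descent of `M` to a finitely generated `B`-module `M₀`
  letI : Module B M := Module.compHom M (algebraMap B C)
  haveI : IsScalarTower B C M := IsScalarTower.of_algebraMap_smul fun _ _ => rfl
  obtain ⟨s, hs⟩ := Module.Finite.fg_top (R := C) (M := M)
  let M₀ : Submodule B M := Submodule.span B (s : Set M)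
  haveI hM₀fin : Module.Finite B M₀ := Module.Finite.iff_fg.mpr (Submodule.fg_span s.finite_toSet)
  have hloc : IsLocalizedModule U M₀.subtype :=
    isLocalizedModule_subtype_of_span_eq_top U M₀ (by
      rw [← hs]; exact Submodule.span_span_of_tower B C (s : Set M))
  have hbc : IsBaseChange C M₀.subtype := IsLocalizedModule.isBaseChange U C M₀.subtype
  let eM : ModuleCat.of C (C ⊗[B] M₀) ≅ M := hbc.equiv.toModuleIso
  -- a `d`-th syzygy `K₀` of `M₀` over `B`: `S`-projective, hence `2`-periodic
  obtain ⟨K₀, hK₀fin, hK₀⟩ := exists_isSyzygy (ModuleCat.of B M₀) d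
  haveI := hK₀fin
  have hK₀proj := projective_restrictScalars_of_isSyzygy hvan hK₀
  letI : Module S K₀ := Module.compHom K₀ (algebraMap S B)
  haveI : IsScalarTower S B K₀ := IsScalarTower.of_algebraMap_smul fun _ _ => rfl
  haveI : Module.Projective S K₀ :=
    (IsProjective.iff_projective (R := S) ((restrictScalarsFunctor S B).obj K₀)).mpr hK₀proj
  have hper₀ : IsSyzygy 2 K₀ K₀ := isSyzygy_two_self pb (Nat.pos_of_ne_zero hdim) K₀
  -- base change to `C`
  let X : ModuleCat.{u} C := ModuleCat.of C (C ⊗[B] K₀)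
  have hXX : IsSyzygy 2 X X := IsSyzygy.baseChange (A := B) (B := C) 2 hper₀
  have hMX : IsSyzygy d M X :=
    (IsSyzygy.baseChange (A := B) (B := C) d hK₀).of_iso_base eM
  -- Schanuel
  obtain ⟨P, P', hPfin, hP, hP'fin, hP', hiso⟩ := IsSyzygy.exists_stablyIso hK hMX
  exact ⟨X, P, P', Module.Finite.base_change B C K₀, hPfin, hP, hP'fin, hP', hiso, 2, two_pos, hXX⟩

/-- **`ca(U⁻¹B) = caᵈ⁺¹(U⁻¹B)`** for `B` with a power basis over a noetherian `S` with `caᵈ⁺¹(S) = S`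
and any submonoid `U ⊆ B`. [OURS] -/
theorem cohomologyAnnihilator_localization_eq_of_powerBasis [IsNoetherianRing S]
    (pb : PowerBasis S B) {d : ℕ} (hvan : cohomologyAnnihilatorOfDegree S (d + 1) = ⊤)
    (U : Submonoid B) :
    cohomologyAnnihilator (Localization U) = cohomologyAnnihilatorOfDegree (Localization U) (d + 1) := by
  refine le_antisymm ?_ (cohomologyAnnihilatorOfDegree_le _)
  intro x hx
  obtain ⟨n, hn⟩ := mem_cohomologyAnnihilator_iff.mp hx
  have hx' : x ∈ cohomologyAnnihilatorOfDegree (Localization U) (max n (d + 1)) :=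
    cohomologyAnnihilatorOfDegree_mono (le_max_left _ _) hn
  rwa [cohomologyAnnihilatorOfDegree_localization_eq_of_powerBasis pb hvan U (le_max_right _ _)]
    at hx'

/-- **The local rings `B_Q`**: `ca(B_Q) = caᵈ⁺¹(B_Q)` for every prime `Q` of an algebra `B` with a
power basis over a noetherian `S` with `caᵈ⁺¹(S) = S`. [OURS] -/
theorem cohomologyAnnihilator_localizationAtPrime_eq_of_powerBasis [IsNoetherianRing S]
    (pb : PowerBasis S B) {d : ℕ} (hvan : cohomologyAnnihilatorOfDegree S (d + 1) = ⊤)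
    (Q : Ideal B) [Q.IsPrime] :
    cohomologyAnnihilator (Localization.AtPrime Q) =
      cohomologyAnnihilatorOfDegree (Localization.AtPrime Q) (d + 1) :=
  cohomologyAnnihilator_localization_eq_of_powerBasis pb hvan Q.primeCompl

/-- **Local rings of a hypersurface over a regular base**: for `S` regular of Krull dimension `≤ d`,
`f ∈ S[X]` monic and any submonoid `U` of `B = S[X]/(f)`: `ca(U⁻¹B) = caᵈ⁺¹(U⁻¹B)`. [OURS] -/
theorem cohomologyAnnihilator_localization_adjoinRoot_eq_of_isRegularRing [IsRegularRing S] {d : ℕ}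
    (hd : ringKrullDim S ≤ d) {f : Polynomial S} (hf : f.Monic) (U : Submonoid (AdjoinRoot f)) :
    cohomologyAnnihilator (Localization U) = cohomologyAnnihilatorOfDegree (Localization U) (d + 1) :=
  cohomologyAnnihilator_localization_eq_of_powerBasis (AdjoinRoot.powerBasis' hf)
    (cohomologyAnnihilatorOfDegree_eq_top_of_isRegularRing S hd) U

/-- **Local rings of an affine hypersurface `k[x₁,…,x_d,X]/(f)`** (`f` monic in `X`, any field `k`,
any characteristic): `ca(U⁻¹B) = caᵈ⁺¹(U⁻¹B)` for every submonoid `U`. [OURS] -/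
theorem cohomologyAnnihilator_localization_adjoinRoot_mvPolynomial_eq (k : Type u) [Field k] (d : ℕ)
    {f : Polynomial (MvPolynomial (Fin d) k)} (hf : f.Monic) (U : Submonoid (AdjoinRoot f)) :
    cohomologyAnnihilator (Localization U) = cohomologyAnnihilatorOfDegree (Localization U) (d + 1) :=
  cohomologyAnnihilator_localization_eq_of_powerBasis (AdjoinRoot.powerBasis' hf)
    (cohomologyAnnihilatorOfDegree_mvPolynomial_eq_top k d) U

end Local

end Summit.ResolutionOfSingularities.ResolutionOfSingularities.Theorems.HomologicalConductor.PeriodicSaturationLocal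

end
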